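import Summits.Ventures.PercRepro.S1CoreCapSpreadChain
import Summits.Ventures.PercRepro.S1FiveCircuitChain

/-!
# PercRepro — THE SOLID ANALYSIS OF THE FIVE-CIRCUITS THROUGH A POINT: THE BASE LEMMAS (p1, gen 33)

`proofs/P1-S2-CORANK6.md` §4k–§4l. The per-point five-circuit caps of the spread `s₅` chain (`S1CoreCapSpreadChainFive`) are the
solid analysis of §4l, IN `M`: a five-circuit through `e` spans a SOLID (its closure: rank `4`, at most `7` points under `¬h4`),
and the caps come from the nullity budget. The general matroid facts that analysis uses, with nothing about any cell:
* `eRk_ne_top_of_finite'`, `exists_eRk_eq_coe` — every rank is finite on a finite matroid;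
* **`eRk_union_add_add_le_encard_add_of_nullity`** — NULLITY IS SUPERADDITIVE, `ν(A ∪ B) + ν(A ∩ B) ≥ ν(A) + ν(B)` (submodularity of the
  rank and `|A ∪ B| + |A ∩ B| = |A| + |B|`), in the form `r(A ∪ B) + a + b ≤ |A ∪ B| + c` when `|A| = r(A) + a`, `|B| = r(B) + b`
  and `|A ∩ B| ≤ r(A ∩ B) + c`;
* **`isColoop_of_notMem_of_nullity_eq`** — a set with the nullity of the whole matroid leaves only coloops outside it (so no circuit
  meets its complement: `Matroid.IsColoop.notMem_isCircuit`);
* `eRk_eq_four_of_fiveCircuit`, `ncard_closure_le_seven_of_fiveCircuit` — the solid of a five-circuit has rank `4` and, under `¬h4`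
  (no set of nullity `4` on `≤ 9` points), at most `7` points;
* `subset_closure_of_subset_of_eRk_le` — a subset of a flat with the flat's rank spans it; **`subset_closure_of_four_le_ncard_inter`** —
  a five-circuit with four points in the solid of another five-circuit lies inside that solid;
* `encard_le_eRk_add_of_subset` — nullity is monotone: `|W| ≤ r(W) + d` on a matroid of nullity `d`;
* `ncard_setOf_subset_ncard_eq'` (`C(|E|, k)` subsets of size `k`; p2's `ncard_setOf_subset_ncard_eq`, restated to keep this file's
  imports inside the S1 lane) and **`ncard_fiveCircuitsThrough_subset_le_choose`** — the five-circuits through `e` inside a set `S` number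
  at most `C(|S ∖ {e}|, 4)` (`15` on a 7-point solid).
Axioms: standard.
-/

open scoped Matroid

namespace PercRepro

namespace S1

open Set

variable {α : Type}

/-- **Every rank is finite on a finite matroid.** -/
theorem eRk_ne_top_of_finite' (M : Matroid α) [M.Finite] (X : Set α) : M.eRk X ≠ ⊤ := by
  rw [← M.eRk_inter_ground]
  exact ne_top_of_le_ne_top (M.ground_finite.subset inter_subset_right).encard_lt_top.ne (M.eRk_le_encard _)

/-- The rank of a set of a finite matroid is a natural number. -/
theorem exists_eRk_eq_coe (M : Matroid α) [M.Finite] (X : Set α) : ∃ r : ℕ, M.eRk X = r :=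
  (ENat.ne_top_iff_exists.1 (eRk_ne_top_of_finite' M X)).imp fun _ h => h.symm

/-- **Nullity is superadditive**: `ν(A ∪ B) + ν(A ∩ B) ≥ ν(A) + ν(B)` — with `|A| = r(A) + a`, `|B| = r(B) + b` and
`|A ∩ B| ≤ r(A ∩ B) + c`, `r(A ∪ B) + a + b ≤ |A ∪ B| + c` (submodularity `r(A ∩ B) + r(A ∪ B) ≤ r(A) + r(B)` and
`|A ∪ B| + |A ∩ B| = |A| + |B|`). -/
theorem eRk_union_add_add_le_encard_add_of_nullity (M : Matroid α) [M.Finite] {A B : Set α} (hA : A ⊆ M.E)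
    (hB : B ⊆ M.E) {a b c : ℕ} (ha : A.encard = M.eRk A + a) (hb : B.encard = M.eRk B + b)
    (hc : (A ∩ B).encard ≤ M.eRk (A ∩ B) + c) :
    M.eRk (A ∪ B) + a + b ≤ (A ∪ B).encard + c := by
  have hAf : A.Finite := M.ground_finite.subset hA
  have hBf : B.Finite := M.ground_finite.subset hB
  have hIf : (A ∩ B).Finite := hAf.subset inter_subset_left
  have hUf : (A ∪ B).Finite := hAf.union hBf
  obtain ⟨rA, hrA⟩ := exists_eRk_eq_coe M A
  obtain ⟨rB, hrB⟩ := exists_eRk_eq_coe M B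
  obtain ⟨rI, hrI⟩ := exists_eRk_eq_coe M (A ∩ B)
  obtain ⟨rU, hrU⟩ := exists_eRk_eq_coe M (A ∪ B)
  have hsub := M.eRk_inter_add_eRk_union_le A B
  rw [hrA, hrB, hrI, hrU] at hsub
  have hsub' : rI + rU ≤ rA + rB := by exact_mod_cast hsub
  have hcard := ncard_union_add_ncard_inter A B hAf hBf
  have ha' : A.ncard = rA + a := by
    have h := ha
    rw [← hAf.cast_ncard_eq, hrA, ← Nat.cast_add] at h
    exact_mod_cast h
  have hb' : B.ncard = rB + b := by
    have h := hb
    rw [← hBf.cast_ncard_eq, hrB, ← Nat.cast_add] at h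
    exact_mod_cast h
  have hc' : (A ∩ B).ncard ≤ rI + c := by
    have h := hc
    rw [← hIf.cast_ncard_eq, hrI, ← Nat.cast_add] at h
    exact_mod_cast h
  rw [hrU, ← hUf.cast_ncard_eq]
  have : rU + a + b ≤ (A ∪ B).ncard + c := by omega
  exact_mod_cast this

/-- **A set with the nullity of the whole matroid leaves only coloops outside it**: if `W ⊆ E`, `r(W) + d ≤ |W|` and
`|E| = r(E) + d`, every point of `E ∖ W` is a coloop (its deletion would drop the rank: `r(E ∖ {x}) ≤ r(W) + |E ∖ W| − 1 ≤ r(E) − 1`). -/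
theorem isColoop_of_notMem_of_nullity_eq (M : Matroid α) [M.Finite] {W : Set α} (hW : W ⊆ M.E) {d : ℕ}
    (hWd : M.eRk W + d ≤ W.encard) (hd : M.E.encard = M.eRank + d) {x : α} (hxE : x ∈ M.E) (hxW : x ∉ W) :
    M.IsColoop x := by
  rw [Matroid.isColoop_iff_notMem_closure_compl hxE]
  intro hcl
  have hEf : M.E.Finite := M.ground_finite
  have hWf : W.Finite := hEf.subset hW
  have h1 : M.eRank ≤ M.eRk (M.E \ {x}) := by
    have hsub : M.E ⊆ M.closure (M.E \ {x}) := by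
      intro y hy
      by_cases hyx : y = x
      · rw [hyx]; exact hcl
      · exact M.subset_closure (M.E \ {x}) sdiff_subset ⟨hy, hyx⟩
    rw [M.eRank_def, ← M.eRk_closure_eq (M.E \ {x})]
    exact M.eRk_mono hsub
  have hWx : W ⊆ M.E \ {x} := fun y hy => ⟨hW hy, fun h => hxW (mem_singleton_iff.1 h ▸ hy)⟩
  have h2 : M.eRk (M.E \ {x}) ≤ M.eRk W + ((M.E \ {x}) \ W).encard := by
    calc M.eRk (M.E \ {x}) = M.eRk (W ∪ ((M.E \ {x}) \ W)) := by
          rw [union_sdiff_self, union_eq_right.2 hWx]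
      _ ≤ M.eRk W + ((M.E \ {x}) \ W).encard := M.eRk_union_le_eRk_add_encard _ _
  have hcard : ((M.E \ {x}) \ W).ncard = M.E.ncard - W.ncard - 1 := by
    rw [sdiff_sdiff_comm, ncard_sdiff_singleton_of_mem (show x ∈ M.E \ W from ⟨hxE, hxW⟩), ncard_sdiff' hW hEf]
  have hlt : W.ncard + 1 ≤ M.E.ncard := by
    have := ncard_le_ncard (insert_subset hxE hW) hEf
    rwa [ncard_insert_of_notMem hxW hWf] at this
  obtain ⟨rE, hrE⟩ := exists_eRk_eq_coe M M.E
  obtain ⟨rW, hrW⟩ := exists_eRk_eq_coe M W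
  obtain ⟨rX, hrX⟩ := exists_eRk_eq_coe M (M.E \ {x})
  have hd' : M.E.ncard = rE + d := by
    have h := hd
    rw [M.eRank_def, hrE, ← hEf.cast_ncard_eq, ← Nat.cast_add] at h
    exact_mod_cast h
  have hWd' : rW + d ≤ W.ncard := by
    have h := hWd
    rw [hrW, ← hWf.cast_ncard_eq, ← Nat.cast_add] at h
    exact_mod_cast h
  have h1' : rE ≤ rX := by
    have h := h1
    rw [M.eRank_def, hrE, hrX] at h
    exact_mod_cast h
  have h2' : rX ≤ rW + ((M.E \ {x}) \ W).ncard := by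
    have h := h2
    rw [hrX, hrW, ← (hEf.subset (sdiff_subset.trans sdiff_subset)).cast_ncard_eq, ← Nat.cast_add] at h
    exact_mod_cast h
  omega

/-- **A five-circuit has rank `4`.** -/
theorem eRk_eq_four_of_fiveCircuit (M : Matroid α) [M.Finite] {C : Set α} (hC : M.IsCircuit C) (h5 : C.ncard = 5) :
    M.eRk C = 4 := by
  have hCf : C.Finite := M.ground_finite.subset hC.subset_ground
  have h := hC.eRk_add_one_eq
  rw [← hCf.cast_ncard_eq, h5] at h
  obtain ⟨r, hr⟩ := exists_eRk_eq_coe M C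
  rw [hr] at h
  have h' : r + 1 = 5 := by exact_mod_cast h
  rw [hr]
  have : r = 4 := by omega
  rw [this]
  rfl

/-- **The solid of a five-circuit has at most `7` points under `¬h4`**: a set of rank `4` has nullity `≤ 3`
(`S2.ncard_le_of_eRk_le_of_not_nullity` at `k = 4`, `w = 9`). -/
theorem ncard_closure_le_seven_of_fiveCircuit (M : Matroid α) [M.Finite]
    (hns : ¬ ∃ W ⊆ M.E, W.ncard ≤ 9 ∧ W.encard = M.eRk W + 4) {C : Set α} (hC : M.IsCircuit C) (h5 : C.ncard = 5) :
    (M.closure C).ncard ≤ 7 := by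
  have h := S2.ncard_le_of_eRk_le_of_not_nullity M 4 9 (by norm_num) hns (M.closure_subset_ground C) (r := 4)
    (by norm_num) (by rw [M.eRk_closure_eq, eRk_eq_four_of_fiveCircuit M hC h5]; norm_num)
  omega

/-- **A subset of a flat with the flat's rank spans it**: `X ⊆ S ⊆ E` and `r(S) ≤ r(X)` give `S ⊆ cl(X)` (a point of `S`
outside `cl(X)` would raise the rank of `X` inside `S`). -/
theorem subset_closure_of_subset_of_eRk_le (M : Matroid α) [M.Finite] {X S : Set α} (hS : S ⊆ M.E) (hXS : X ⊆ S)
    (hr : M.eRk S ≤ M.eRk X) : S ⊆ M.closure X := by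
  intro s hs
  by_contra hsX
  have h1 := Matroid.eRk_insert_eq_add_one (M := M) ⟨hS hs, hsX⟩
  have h2 : M.eRk (insert s X) ≤ M.eRk S := M.eRk_mono (insert_subset hs hXS)
  rw [h1] at h2
  exact lt_irrefl _ ((ENat.add_one_le_iff (eRk_ne_top_of_finite' M X)).1 (h2.trans hr))

/-- **Four points in the solid of another five-circuit pull the whole circuit in**: `C ⊆ cl(C₀)` whenever `|C ∩ cl(C₀)| ≥ 4`
(the four points are `C ∖ {y}`, whose closure contains `C` and lies in the flat `cl(C₀)`). -/
theorem subset_closure_of_four_le_ncard_inter (M : Matroid α) [M.Finite] {C C₀ : Set α} (hC : M.IsCircuit C)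
    (h5 : C.ncard = 5) (h4 : 4 ≤ (C ∩ M.closure C₀).ncard) : C ⊆ M.closure C₀ := by
  obtain ⟨T, hT, hT4⟩ := Set.exists_subset_card_eq h4
  have hTC : T ⊆ C := hT.trans inter_subset_left
  have hTS : T ⊆ M.closure C₀ := hT.trans inter_subset_right
  have hCf : C.Finite := M.ground_finite.subset hC.subset_ground
  have hdiff : (C \ T).ncard = 1 := by rw [ncard_sdiff' hTC hCf, h5, hT4]
  obtain ⟨y, hy⟩ := ncard_eq_one.1 hdiff
  have hTeq : T = C \ {y} := by
    rw [← hy, sdiff_sdiff_cancel_left hTC]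
  have hsub := hC.subset_closure_sdiff_singleton y
  rw [← hTeq] at hsub
  have hclT : M.closure T ⊆ M.closure C₀ := by
    have := M.closure_mono hTS
    rwa [M.closure_closure] at this
  exact hsub.trans hclT

/-- **Subsets of size `k` of a finite set number `C(|E|, k)`** (p2's `ncard_setOf_subset_ncard_eq`, restated here so that this
file imports only the S1 lane). -/
theorem ncard_setOf_subset_ncard_eq' {E : Set α} (hE : E.Finite) (k : ℕ) :
    {A : Set α | A ⊆ E ∧ A.ncard = k}.ncard = Nat.choose E.ncard k := by
  have himage : {A : Set α | A ⊆ E ∧ A.ncard = k} =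
      (fun B : Finset α => (B : Set α)) ''
        ((Finset.powersetCard k hE.toFinset : Finset (Finset α)) : Set (Finset α)) := by
    ext A
    simp only [mem_setOf_eq, mem_image, Finset.mem_coe, Finset.mem_powersetCard]
    constructor
    · rintro ⟨hAE, hAk⟩
      have hAfin : A.Finite := hE.subset hAE
      refine ⟨hAfin.toFinset, ⟨Finite.toFinset_subset_toFinset.mpr hAE, ?_⟩, hAfin.coe_toFinset⟩
      rw [← ncard_eq_toFinset_card A hAfin]
      exact hAk
    · rintro ⟨B, ⟨hBE, hBk⟩, rfl⟩
      refine ⟨?_, ?_⟩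
      · intro x hx
        have hx' : x ∈ hE.toFinset := hBE (Finset.mem_coe.mp hx)
        rwa [Finite.mem_toFinset] at hx'
      · rw [ncard_coe_finset]
        exact hBk
  rw [himage, ncard_image_of_injective _ Finset.coe_injective, ncard_coe_finset,
    Finset.card_powersetCard, ncard_eq_toFinset_card E hE]

/-- **The five-circuits through `e` inside a set `S` number at most `C(|S ∖ {e}|, 4)`**: `C ↦ C ∖ {e}` is an injection into the
4-subsets of `S ∖ {e}`. -/
theorem ncard_fiveCircuitsThrough_subset_le_choose (M : Matroid α) [M.Finite] {S : Set α} (hS : S ⊆ M.E) (e : α) :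
    {C : Set α | M.IsCircuit C ∧ C.ncard = 5 ∧ e ∈ C ∧ C ⊆ S}.ncard ≤ (S \ {e}).ncard.choose 4 := by
  classical
  have hSf : S.Finite := M.ground_finite.subset hS
  have hSef : (S \ {e}).Finite := hSf.subset sdiff_subset
  rw [← ncard_setOf_subset_ncard_eq' hSef 4]
  refine Set.ncard_le_ncard_of_injOn (fun C => C \ {e}) ?_ ?_ (hSef.finite_subsets.subset (fun A hA => hA.1))
  · rintro C ⟨hC, h5, heC, hCS⟩
    refine ⟨sdiff_subset_sdiff_left hCS, ?_⟩
    rw [ncard_sdiff_singleton_of_mem heC, h5]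
  · rintro C ⟨-, -, heC, -⟩ C' ⟨-, -, heC', -⟩ h
    simp only at h
    have h1 : C = insert e (C \ {e}) := by
      rw [Set.insert_sdiff_singleton, Set.insert_eq_of_mem heC]
    have h2 : C' = insert e (C' \ {e}) := by
      rw [Set.insert_sdiff_singleton, Set.insert_eq_of_mem heC']
    rw [h1, h2, h]

/-- **Nullity is monotone**: `|W| ≤ r(W) + d` for every `W ⊆ E` when `|E| = r(E) + d` (`r(E) ≤ r(W) + |E ∖ W|`). -/
theorem encard_le_eRk_add_of_subset (M : Matroid α) [M.Finite] {W : Set α} (hW : W ⊆ M.E) {d : ℕ}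
    (hd : M.E.encard = M.eRank + d) : W.encard ≤ M.eRk W + d := by
  have hEf : M.E.Finite := M.ground_finite
  have hWf : W.Finite := hEf.subset hW
  have h1 : M.eRank ≤ M.eRk W + (M.E \ W).encard := by
    have h := M.eRk_union_le_eRk_add_encard W (M.E \ W)
    rwa [union_sdiff_cancel hW, ← M.eRank_def] at h
  obtain ⟨rE, hrE⟩ := exists_eRk_eq_coe M M.E
  obtain ⟨rW, hrW⟩ := exists_eRk_eq_coe M W
  have hd' : M.E.ncard = rE + d := by
    have h := hd
    rw [M.eRank_def, hrE, ← hEf.cast_ncard_eq, ← Nat.cast_add] at h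
    exact_mod_cast h
  have h1' : rE ≤ rW + (M.E \ W).ncard := by
    have h := h1
    rw [M.eRank_def, hrE, hrW, ← (hEf.subset sdiff_subset).cast_ncard_eq, ← Nat.cast_add] at h
    exact_mod_cast h
  have hcard : (M.E \ W).ncard = M.E.ncard - W.ncard := ncard_sdiff' hW hEf
  have hle : W.ncard ≤ M.E.ncard := ncard_le_ncard hW hEf
  rw [hrW, ← hWf.cast_ncard_eq, ← Nat.cast_add]
  have : W.ncard ≤ rW + d := by omega
  exact_mod_cast this

end S1

end PercRepro
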